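import Literature.NumberTheory.Rogawski1990.FinExplicitTransferFactorLeviStratumFrame   -- ★ S3-B `finExplicitDelta_cmDatumLocalCongr_endoEmbLocal_eq_of_exists`
import Literature.NumberTheory.Rogawski1990.FinExplicitTransferFactorNondegenerate       -- ★ `finTau_ne_zero_of_isLocalGRegular`, `finWeylRatio_ne_zero_of_isLocalGRegular`
import Literature.NumberTheory.Rogawski1990.UnitFundamentalLemmaInertLevi               -- ★ `isUnit_levi_of_isLocalGRegular_of_nonsplit`, `isUnit_vecCons_sub_of_levi`
import Literature.NumberTheory.Rogawski1990.FinExplicitTransferFactor                    -- ★ `finExplicitCollection`, `finExplicitCollection_Δ`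
import Literature.NumberTheory.Rogawski1990.AdelicKappaOrbitalEulerGp                    -- ★ `TransferFactorData.Δ_out_mk`
import Literature.NumberTheory.Rogawski1990.CMLocalAPacketMembers                        -- ★ `qsForm`, `Gqs`
import Literature.NumberTheory.Automorphic.UnitaryGroupFormCongrFinSum                     -- ★ `formCongr_one_eq` (the quasi-split frame `T₀ = 1`)
import HarnessLib

/-!
# F0 · P3c · line LH6 «StCharTS» — road (D) «DEEP-FL», brick (c₃) «Δ‴ AT THE MATCHED LEVI CLASS»: for a G-regular diagonal-Levi `γ_H`, the class
# `c₀ = [e(ι_v γ_H)]` is Δ‴-matched with `Δ‴(γ_H, out c₀) = τ_v(γ_H) · D_{G/H,v}(γ_H) ≠ 0`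

Cell `pub/hodgecm-mathlib`, crux H413 = `stmt-HodgeConjecture-24833` (lane `--supports … --as helper`), route HCCMUnconditional; seat LH6-p03 (g0); desk F0P3b-plan (g23)
DEAL «(c₃)» 05:38:48Z; road (D) owner LH6-p04 (g2), status v4 `F0/P3b/LH6-p04/g2/ROAD-D.status.v4.txt` § (c₃).  THEOREMS ONLY, sorry-free, ★-only imports; no definition ∕
instance ∕ notation ∕ named fact.  HONEST LABEL: HC_CM is proved only modulo the 7 printed citations (2 remaining: hLiu418 = stmt-HodgeConjecture-24832, h413 =
stmt-HodgeConjecture-24833) until rung 0 closes; count-neutral plumbing of road (D) (one feeder of the open socket `hlevi` of ★ `isLocalDeltaTransfer_of_levi`).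

THE MATHEMATICS ([Rogawski1990, §4.9 p. 55: on the Levi stratum `Δ_{G/H} = τ · D_{G/H}`]; ★ S3-B `finExplicitDelta_cmDatumLocalCongr_endoEmbLocal_eq_of_exists`): at a
NON-SPLIT place (`c • w = w`), for a frame `(T₀, a)` of the inner form `U(H′)` with `a` a norm (`a = z·z̄`, `z` a unit — e.g. the quasi-split frame `T₀ = 1`, `a = 1`) and a
G-regular `γ_H = (diag(d′₀, d′₁), u) ∈ H_v` on the diagonal Levi: the class `c₀` of `e(ι_v γ_H)` (`e = cmDatumLocalCongr L v T₀ ha h`) has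
`Δ‴_v(γ_H, out c₀) = finTau L v γ_H μ · finWeylRatio L v γ_H`, and this is NON-ZERO (★ `finTau_ne_zero_of_isLocalGRegular`, ★ `finWeylRatio_ne_zero_of_isLocalGRegular`);
the three Levi units of S3-B's `hreg` come from G-regularity (★ `isUnit_levi_of_isLocalGRegular_of_nonsplit` + ★ `isUnit_vecCons_sub_of_levi`), the diagonal form of
`ι_v γ_H` from ★ `endoEmbLocal_eq_glDiagonal_of_fst_eq`, and `Δ(γ_H, out [g]) = Δ(γ_H, g)` is ★ `TransferFactorData.Δ_out_mk`.  With ★ `OnStratumG` (one matched class ON the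
stratum) this pins the right side of `hlevi` to `τ·D·Φ(c₀, 𝟙_{K_n b K_n})`.

## References
* [Rogawski1990] J. D. Rogawski, *Automorphic Representations of Unitary Groups in Three Variables*, Ann. of Math. Stud. 123 (1990): §4.9 p. 55; §4.3 (4.3.1) p. 43;
  §12.7 L. 12.7.3 (proof) p. 195.
-/

set_option autoImplicit false
-- the mandated namespace has the single-problem summit's repeated segment (`HodgeConjecture.HodgeConjecture`)
set_option linter.dupNamespace false

noncomputable section

open Matrix NumberField IsDedekindDomain
open scoped MatrixGroups
open Literature.NumberTheory.Rogawski1990 Literature.NumberTheory.Automorphic Literature.NumberTheory.Automorphic.UnitaryGroup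
open Literature.NumberTheory.GaloisRepresentations

namespace Summit.HodgeConjecture.HodgeConjecture.Cruxes.H413.F0P3cStCharTSDeltaAtLevi

variable (L : Type) [Field L] [NumberField L] [IsCMField L] (H' : Matrix (Fin 3) (Fin 3) L)
  {v : HeightOneSpectrum (𝓞 ↥(maximalRealSubfield L))}

open scoped Classical in
set_option maxHeartbeats 1600000 in  -- statement-level `whnf` on the CM carriers (same class as ★ S3-B's consumers)
/-- **(c₃) «Δ‴ AT THE MATCHED LEVI CLASS», general frame.**  At a non-split `w ∣ v`, for a frame `(T₀, a)` of `U(H′)_v` (`formCongr σ T₀ H′ = a·Φ₃`) with `a = z·σ(z)` for a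
unit `z`, the two invariance families `hl, hr` of Δ‴ (★ `finExplicitCollection`), and a G-regular `γ_H ∈ H_v` whose `U(Φ₂)`-block is `diag(d′₀, d′₁)`: the class
`c₀ := [e(ι_v γ_H)]` satisfies `Δ‴_v(γ_H, out c₀) = finTau L v γ_H μ · finWeylRatio L v γ_H` and `Δ‴_v(γ_H, out c₀) ≠ 0`.
[cite: Rogawski1990, §4.9 p. 55; §4.3 (4.3.1) p. 43] -/
theorem delta_out_mk_cmDatumLocalCongr_endoEmbLocal_eq_and_ne_zero
    (w : PlacesOver L v) (hw : IsCMField.complexConj L • w.1 = w.1)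
    (T₀ : GL (Fin 3) (UnitaryGroup.LocalRing L v)) {a : UnitaryGroup.LocalRing L v} (ha : IsUnit a)
    (h : formCongr (conjLocal L (IsCMField.complexConj L) v) T₀ (H'.map (algebraMap L (UnitaryGroup.LocalRing L v))) =
      a • (Matrix.of fun i j : Fin 3 => if i.val + j.val + 1 = 3 then (1 : L) else 0).map (algebraMap L (UnitaryGroup.LocalRing L v)))
    (hnorm : ∃ z : UnitaryGroup.LocalRing L v, IsUnit z ∧ a = z * conjLocal L (IsCMField.complexConj L) v z)
    (μ : HeckeCharacter L)
    (hl : ∀ (v : HeightOneSpectrum (𝓞 ↥(maximalRealSubfield L)))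
      (a : (UnitaryGroup.cmDatum L 2 (Matrix.of fun i j : Fin 2 => if i.val + j.val + 1 = 2 then (1 : L) else 0)).Local v ×
      (UnitaryGroup.cmDatum L 1 (Matrix.of fun i j : Fin 1 => if i.val + j.val + 1 = 1 then (1 : L) else 0)).Local v)
      (b : (UnitaryGroup.cmDatum L 3 H').Local v)
      (x : (UnitaryGroup.cmDatum L 2 (Matrix.of fun i j : Fin 2 => if i.val + j.val + 1 = 2 then (1 : L) else 0)).Local v ×
      (UnitaryGroup.cmDatum L 1 (Matrix.of fun i j : Fin 1 => if i.val + j.val + 1 = 1 then (1 : L) else 0)).Local v),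
      finExplicitDelta L v H' (x * a * x⁻¹) μ b = finExplicitDelta L v H' a μ b)
    (hr : ∀ (v : HeightOneSpectrum (𝓞 ↥(maximalRealSubfield L)))
      (a : (UnitaryGroup.cmDatum L 2 (Matrix.of fun i j : Fin 2 => if i.val + j.val + 1 = 2 then (1 : L) else 0)).Local v ×
      (UnitaryGroup.cmDatum L 1 (Matrix.of fun i j : Fin 1 => if i.val + j.val + 1 = 1 then (1 : L) else 0)).Local v)
      (b y : (UnitaryGroup.cmDatum L 3 H').Local v),
      finExplicitDelta L v H' a μ (y * b * y⁻¹) = finExplicitDelta L v H' a μ b)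
    (γH : (cmDatum L 2 (Matrix.of fun i j : Fin 2 => if i.val + j.val + 1 = 2 then (1 : L) else 0)).Local v ×
      (cmDatum L 1 (Matrix.of fun i j : Fin 1 => if i.val + j.val + 1 = 1 then (1 : L) else 0)).Local v)
    {d' : Fin 2 → (UnitaryGroup.LocalRing L v)ˣ} (hd' : glDiagonal 2 (UnitaryGroup.LocalRing L v) d' = (γH.1.val : GL (Fin 2) (UnitaryGroup.LocalRing L v)))
    (hreg : IsLocalGRegular L v γH) :
    (finExplicitCollection L H' μ hl hr v).Δ γH (Quotient.out (ConjClasses.mk (cmDatumLocalCongr L v T₀ ha h (endoEmbLocal L v γH)))) =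
        finTau L v γH μ * (finWeylRatio L v γH : ℂ) ∧
      (finExplicitCollection L H' μ hl hr v).Δ γH (Quotient.out (ConjClasses.mk (cmDatumLocalCongr L v T₀ ha h (endoEmbLocal L v γH)))) ≠ 0 := by
  -- the diagonal form of `ι_v γ_H` and the three Levi units from G-regularity
  have hι := endoEmbLocal_eq_glDiagonal_of_fst_eq L v γH hd'
  have hlev := isUnit_levi_of_isLocalGRegular_of_nonsplit L w hw hd' hreg
  rcases hlev with ⟨hua, hub, h12⟩
  have hu : (((isUnit_finGammaTwo L v γH).unit : (UnitaryGroup.LocalRing L v)ˣ) : UnitaryGroup.LocalRing L v) = finGammaTwo L v γH :=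
    (isUnit_finGammaTwo L v γH).unit_spec
  have hreg3 := isUnit_vecCons_sub_of_levi hua hub (by rw [hu]; exact h12)
  -- S3-B at the frame `(T₀, a)`
  have key := finExplicitDelta_cmDatumLocalCongr_endoEmbLocal_eq_of_exists L H' w hw T₀ ha h μ γH hι hreg3 hnorm
  have hΔ : (finExplicitCollection L H' μ hl hr v).Δ γH (Quotient.out (ConjClasses.mk (cmDatumLocalCongr L v T₀ ha h (endoEmbLocal L v γH)))) =
      finTau L v γH μ * (finWeylRatio L v γH : ℂ) := by
    rw [TransferFactorData.Δ_out_mk, finExplicitCollection_Δ]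
    exact key
  refine ⟨hΔ, ?_⟩
  rw [hΔ]
  exact mul_ne_zero (finTau_ne_zero_of_isLocalGRegular L v γH μ hreg) (Complex.ofReal_ne_zero.2 (finWeylRatio_ne_zero_of_isLocalGRegular L v γH hreg))

open scoped Classical in
set_option maxHeartbeats 1600000 in
/-- **(c₃), packaged as the feeder of `hlevi`**: under the same data, THERE IS a class `c₀` of `U(H′)_v` with `Δ‴_v(γ_H, out c₀) = finTau·finWeylRatio` and
`Δ‴_v(γ_H, out c₀) ≠ 0` (namely `[e(ι_v γ_H)]`). [cite: Rogawski1990, §4.9 p. 55; §4.3 (4.3.1) p. 43] -/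
theorem exists_class_delta_eq_finTau_mul_finWeylRatio
    (w : PlacesOver L v) (hw : IsCMField.complexConj L • w.1 = w.1)
    (T₀ : GL (Fin 3) (UnitaryGroup.LocalRing L v)) {a : UnitaryGroup.LocalRing L v} (ha : IsUnit a)
    (h : formCongr (conjLocal L (IsCMField.complexConj L) v) T₀ (H'.map (algebraMap L (UnitaryGroup.LocalRing L v))) =
      a • (Matrix.of fun i j : Fin 3 => if i.val + j.val + 1 = 3 then (1 : L) else 0).map (algebraMap L (UnitaryGroup.LocalRing L v)))
    (hnorm : ∃ z : UnitaryGroup.LocalRing L v, IsUnit z ∧ a = z * conjLocal L (IsCMField.complexConj L) v z)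
    (μ : HeckeCharacter L)
    (hl : ∀ (v : HeightOneSpectrum (𝓞 ↥(maximalRealSubfield L)))
      (a : (UnitaryGroup.cmDatum L 2 (Matrix.of fun i j : Fin 2 => if i.val + j.val + 1 = 2 then (1 : L) else 0)).Local v ×
      (UnitaryGroup.cmDatum L 1 (Matrix.of fun i j : Fin 1 => if i.val + j.val + 1 = 1 then (1 : L) else 0)).Local v)
      (b : (UnitaryGroup.cmDatum L 3 H').Local v)
      (x : (UnitaryGroup.cmDatum L 2 (Matrix.of fun i j : Fin 2 => if i.val + j.val + 1 = 2 then (1 : L) else 0)).Local v ×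
      (UnitaryGroup.cmDatum L 1 (Matrix.of fun i j : Fin 1 => if i.val + j.val + 1 = 1 then (1 : L) else 0)).Local v),
      finExplicitDelta L v H' (x * a * x⁻¹) μ b = finExplicitDelta L v H' a μ b)
    (hr : ∀ (v : HeightOneSpectrum (𝓞 ↥(maximalRealSubfield L)))
      (a : (UnitaryGroup.cmDatum L 2 (Matrix.of fun i j : Fin 2 => if i.val + j.val + 1 = 2 then (1 : L) else 0)).Local v ×
      (UnitaryGroup.cmDatum L 1 (Matrix.of fun i j : Fin 1 => if i.val + j.val + 1 = 1 then (1 : L) else 0)).Local v)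
      (b y : (UnitaryGroup.cmDatum L 3 H').Local v),
      finExplicitDelta L v H' a μ (y * b * y⁻¹) = finExplicitDelta L v H' a μ b)
    (γH : (cmDatum L 2 (Matrix.of fun i j : Fin 2 => if i.val + j.val + 1 = 2 then (1 : L) else 0)).Local v ×
      (cmDatum L 1 (Matrix.of fun i j : Fin 1 => if i.val + j.val + 1 = 1 then (1 : L) else 0)).Local v)
    {d' : Fin 2 → (UnitaryGroup.LocalRing L v)ˣ} (hd' : glDiagonal 2 (UnitaryGroup.LocalRing L v) d' = (γH.1.val : GL (Fin 2) (UnitaryGroup.LocalRing L v)))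
    (hreg : IsLocalGRegular L v γH) :
    ∃ c₀ : ConjClasses ((cmDatum L 3 H').Local v),
      (finExplicitCollection L H' μ hl hr v).Δ γH (Quotient.out c₀) = finTau L v γH μ * (finWeylRatio L v γH : ℂ) ∧
      (finExplicitCollection L H' μ hl hr v).Δ γH (Quotient.out c₀) ≠ 0 :=
  ⟨_, delta_out_mk_cmDatumLocalCongr_endoEmbLocal_eq_and_ne_zero L H' w hw T₀ ha h hnorm μ hl hr γH hd' hreg⟩

/-- The quasi-split frame: `formCongr σ 1 Φ₃ = 1 • Φ₃` on `U(Φ₃)(L⁺_v)` (★ `formCongr_one_eq`). [cite: Rogawski1990, §4.9 p. 55] -/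
theorem formCongr_one_qsForm (v : HeightOneSpectrum (𝓞 ↥(maximalRealSubfield L))) :
    formCongr (conjLocal L (IsCMField.complexConj L) v) (1 : GL (Fin 3) (UnitaryGroup.LocalRing L v))
        ((qsForm L).map (algebraMap L (UnitaryGroup.LocalRing L v))) =
      (1 : UnitaryGroup.LocalRing L v) • (Matrix.of fun i j : Fin 3 => if i.val + j.val + 1 = 3 then (1 : L) else 0).map (algebraMap L (UnitaryGroup.LocalRing L v)) := by
  rw [formCongr_one_eq, one_smul]

/-- `1 = z·σ(z)` with `z = 1` a unit: the quasi-split frame's scalar is a norm. [cite: Rogawski1990, §4.9 p. 55] -/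
theorem exists_isUnit_one_eq_mul_conj (v : HeightOneSpectrum (𝓞 ↥(maximalRealSubfield L))) :
    ∃ z : UnitaryGroup.LocalRing L v, IsUnit z ∧ (1 : UnitaryGroup.LocalRing L v) = z * conjLocal L (IsCMField.complexConj L) v z :=
  ⟨1, isUnit_one, by rw [map_one, mul_one]⟩

open scoped Classical in
set_option maxHeartbeats 1600000 in
/-- **(c₃) AT THE QUASI-SPLIT FORM (`H′ = Φ₃`, frame `T₀ = 1`, `a = 1`)** — the shape road (D) consumes (`T = finExplicitCollection L (qsForm L) μ hl hr v`, e.g. with the ★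
invariance families `finExplicitDelta_conj_left_all` ∕ `finExplicitDelta_conj_right_all`): for a G-regular diagonal-Levi `γ_H`, the class `[e(ι_v γ_H)]`
(`e = cmDatumLocalCongr L v 1 isUnit_one (formCongr_one_qsForm L v)`) has `Δ‴_v(γ_H, out c₀) = finTau L v γ_H μ · finWeylRatio L v γ_H ≠ 0`; packaged as `∃ c₀`.
[cite: Rogawski1990, §4.9 p. 55; §4.3 (4.3.1) p. 43; §12.7 L. 12.7.3 (proof) p. 195] -/
theorem exists_class_delta_eq_finTau_mul_finWeylRatio_qsForm
    (w : PlacesOver L v) (hw : IsCMField.complexConj L • w.1 = w.1) (μ : HeckeCharacter L)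
    (hl : ∀ (v : HeightOneSpectrum (𝓞 ↥(maximalRealSubfield L)))
      (a : (UnitaryGroup.cmDatum L 2 (Matrix.of fun i j : Fin 2 => if i.val + j.val + 1 = 2 then (1 : L) else 0)).Local v ×
      (UnitaryGroup.cmDatum L 1 (Matrix.of fun i j : Fin 1 => if i.val + j.val + 1 = 1 then (1 : L) else 0)).Local v)
      (b : (UnitaryGroup.cmDatum L 3 (qsForm L)).Local v)
      (x : (UnitaryGroup.cmDatum L 2 (Matrix.of fun i j : Fin 2 => if i.val + j.val + 1 = 2 then (1 : L) else 0)).Local v ×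
      (UnitaryGroup.cmDatum L 1 (Matrix.of fun i j : Fin 1 => if i.val + j.val + 1 = 1 then (1 : L) else 0)).Local v),
      finExplicitDelta L v (qsForm L) (x * a * x⁻¹) μ b = finExplicitDelta L v (qsForm L) a μ b)
    (hr : ∀ (v : HeightOneSpectrum (𝓞 ↥(maximalRealSubfield L)))
      (a : (UnitaryGroup.cmDatum L 2 (Matrix.of fun i j : Fin 2 => if i.val + j.val + 1 = 2 then (1 : L) else 0)).Local v ×
      (UnitaryGroup.cmDatum L 1 (Matrix.of fun i j : Fin 1 => if i.val + j.val + 1 = 1 then (1 : L) else 0)).Local v)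
      (b y : (UnitaryGroup.cmDatum L 3 (qsForm L)).Local v),
      finExplicitDelta L v (qsForm L) a μ (y * b * y⁻¹) = finExplicitDelta L v (qsForm L) a μ b)
    (γH : (cmDatum L 2 (Matrix.of fun i j : Fin 2 => if i.val + j.val + 1 = 2 then (1 : L) else 0)).Local v ×
      (cmDatum L 1 (Matrix.of fun i j : Fin 1 => if i.val + j.val + 1 = 1 then (1 : L) else 0)).Local v)
    {d' : Fin 2 → (UnitaryGroup.LocalRing L v)ˣ} (hd' : glDiagonal 2 (UnitaryGroup.LocalRing L v) d' = (γH.1.val : GL (Fin 2) (UnitaryGroup.LocalRing L v)))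
    (hreg : IsLocalGRegular L v γH) :
    ∃ c₀ : ConjClasses (Gqs L v),
      c₀ = ConjClasses.mk (cmDatumLocalCongr L v (1 : GL (Fin 3) (UnitaryGroup.LocalRing L v)) isUnit_one (formCongr_one_qsForm L v) (endoEmbLocal L v γH)) ∧
      (finExplicitCollection L (qsForm L) μ hl hr v).Δ γH (Quotient.out c₀) = finTau L v γH μ * (finWeylRatio L v γH : ℂ) ∧
      (finExplicitCollection L (qsForm L) μ hl hr v).Δ γH (Quotient.out c₀) ≠ 0 :=
  ⟨_, rfl, delta_out_mk_cmDatumLocalCongr_endoEmbLocal_eq_and_ne_zero L (qsForm L) w hw 1 isUnit_one (formCongr_one_qsForm L v)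
    (exists_isUnit_one_eq_mul_conj L v) μ hl hr γH hd' hreg⟩

end Summit.HodgeConjecture.HodgeConjecture.Cruxes.H413.F0P3cStCharTSDeltaAtLevi

end
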